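import Mathlib

/-!
# Route `PoincareLipschitz` (planner ym-r3-idea-2 g7, LINE 15), glue `TwoSidedOfConcentration` (stmt-QuantumFields-23535) —
# helper 1: the ABSTRACT McSHANE (inf-convolution) EXTENSION

The planner's proof plan for the glue `MesoscopicConcentrationL → BlockLipschitzL → BlockLocalityL → MeanDeviationL →
TwoSidedTailL ∧ TowerTailL` extends the level-`j` block-plaquette deviation `f_a = dist1(Ū^j(∂a))`, which is Lipschitz only on the
LOCAL GOOD SET `G(a,j)` (crux `BlockLipschitzL`), to an everywhere-Lipschitz, bounded, symmetric, box-local observable to which the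
concentration hypothesis `MesoscopicConcentrationL` applies.  This file is the measure-free, lattice-free core of that step:

for a pseudometric `d` on a topological space `X` (continuous in its first argument), a set `G ⊆ X`, a function `f ≥ 0` that is
`Λ`-Lipschitz for `d` ON `G`, and a cap `θ ≥ 0`, the capped inf-convolution
`g(x) = min(θ, inf_{y ∈ G} (f(y) + Λ·d(x,y)))` satisfies: `0 ≤ g ≤ θ`; `g ≤ f` on `G`; `g = θ` on `G ∩ {θ ≤ f}`; `g` is `Λ`-Lipschitz
EVERYWHERE; `g` is invariant under every self-map of `X` preserving `d`, `f` and `G` (with a quasi-inverse); `g(x)` depends on `x` only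
through `d(x,·)` (locality); and `g` is Borel measurable (`{g < t}` is open).  Stated as an existence theorem (no definitions).

Width seat ym-line-sfw-p2-w3 g30 (cell ym-idea-1, R3 family; free hands), `--supports stmt-QuantumFields-23535`.  Elementary real analysis;
no crux, rung (R3 is a RECORD rung) or summit is proved; the Yang–Mills mass gap is NOT proved.
-/

set_option autoImplicit false

namespace Summit.QuantumFields.YangMills.Theorems.PoincareLipschitz.TwoSidedOfConcentration

open Set

/-- **McShane extension, abstract form.**  Let `d : X → X → ℝ` be a pseudometric on a topological space `X` whose Borel sets are
measurable (`0 ≤ d`, `d x x = 0`, symmetric, triangle inequality, `x ↦ d x y` continuous), `G ⊆ X`, `f ≥ 0` `Λ`-Lipschitz for `d` on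
`G` (`Λ ≥ 0`), `θ ≥ 0`.  Suppose a family of maps `act a : X → X` (`a : A`) preserves `d`, `f` and `G`, each with a quasi-inverse
`act a (act a' x) = x`, and let `R` be a relation such that `R x x'` forces `d x · = d x' ·`.  Then there is `g : X → ℝ` with
`0 ≤ g ≤ θ`, `g ≤ f` on `G`, `g = θ` on `G ∩ {θ ≤ f}`, `|g x − g x'| ≤ Λ·d x x'` for ALL `x, x'`, `g (act a x) = g x`, `R x x' → g x = g x'`,
and `g` measurable (McShane 1934 / Whitney: `g = θ ⊓ ⨅_{y ∈ G} (f y + Λ d(·,y))`). [folklore] -/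
theorem exists_capped_infConvolution {X : Type*} [TopologicalSpace X] [MeasurableSpace X] [OpensMeasurableSpace X]
    (d : X → X → ℝ) (hd0 : ∀ x y, 0 ≤ d x y) (hdself : ∀ x, d x x = 0) (hdcomm : ∀ x y, d x y = d y x)
    (hdtri : ∀ x y z, d x z ≤ d x y + d y z) (hdcont : ∀ y, Continuous fun x => d x y)
    (G : Set X) (f : X → ℝ) (hf0 : ∀ x, 0 ≤ f x) (θ Λ : ℝ) (hθ : 0 ≤ θ) (hΛ : 0 ≤ Λ)
    (hLip : ∀ x ∈ G, ∀ y ∈ G, |f x - f y| ≤ Λ * d x y)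
    {A : Type*} (act : A → X → X) (hactG : ∀ a x, x ∈ G → act a x ∈ G) (hactf : ∀ a x, f (act a x) = f x)
    (hactd : ∀ a x y, d (act a x) (act a y) = d x y) (hactinv : ∀ a : A, ∃ a' : A, ∀ x, act a (act a' x) = x)
    (R : X → X → Prop) (hR : ∀ x x', R x x' → ∀ y, d x y = d x' y) :
    ∃ g : X → ℝ, (∀ x, 0 ≤ g x) ∧ (∀ x, g x ≤ θ) ∧ (∀ x ∈ G, g x ≤ f x) ∧ (∀ x ∈ G, θ ≤ f x → g x = θ) ∧
      (∀ x x', |g x - g x'| ≤ Λ * d x x') ∧ (∀ a x, g (act a x) = g x) ∧ (∀ x x', R x x' → g x = g x') ∧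
      Measurable g := by
  classical
  -- the index type: points of `G`, plus one index for the cap `θ`
  let ι : Type _ := Option G
  let φ : ι → X → ℝ := fun i x => match i with
    | none => θ
    | some y => f y + Λ * d x y
  have hφ0 : ∀ i x, 0 ≤ φ i x := by
    rintro (_ | y) x
    · exact hθ
    · exact add_nonneg (hf0 _) (mul_nonneg hΛ (hd0 _ _))
  have hbdd : ∀ x, BddBelow (range fun i => φ i x) := fun x => ⟨0, by rintro _ ⟨i, rfl⟩; exact hφ0 i x⟩
  haveI : Nonempty ι := ⟨none⟩
  let g : X → ℝ := fun x => ⨅ i, φ i x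
  have hg_le : ∀ i x, g x ≤ φ i x := fun i x => ciInf_le (hbdd x) i
  have hg_theta : ∀ x, g x ≤ θ := fun x => hg_le none x
  have hg0 : ∀ x, 0 ≤ g x := fun x => le_ciInf fun i => hφ0 i x
  -- continuity of each `φ i`
  have hφcont : ∀ i, Continuous (φ i) := by
    rintro (_ | y)
    · exact continuous_const
    · exact continuous_const.add (continuous_const.mul (hdcont _))
  refine ⟨g, hg0, hg_theta, ?_, ?_, ?_, ?_, ?_, ?_⟩
  · -- `g ≤ f` on `G`
    intro x hx
    have h := hg_le (some ⟨x, hx⟩) x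
    have hφx : φ (some ⟨x, hx⟩) x = f x + Λ * d x x := rfl
    rw [hφx, hdself, mul_zero, add_zero] at h
    exact h
  · -- `g = θ` on `G ∩ {θ ≤ f}`
    intro x hx hθf
    refine le_antisymm (hg_theta x) (le_ciInf ?_)
    rintro (_ | ⟨y, hy⟩)
    · exact le_rfl
    · show θ ≤ f y + Λ * d x y
      have h := hLip x hx y hy
      have h' : f x - f y ≤ Λ * d x y := (le_abs_self _).trans h
      linarith
  · -- global Lipschitz
    have key : ∀ x x', g x ≤ g x' + Λ * d x x' := by
      intro x x'
      have h : ∀ i, g x - Λ * d x x' ≤ φ i x' := by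
        rintro (_ | ⟨y, hy⟩)
        · show g x - Λ * d x x' ≤ θ
          have := hg_theta x
          nlinarith [hd0 x x']
        · show g x - Λ * d x x' ≤ f y + Λ * d x' y
          have h1 : g x ≤ f y + Λ * d x y := hg_le (some ⟨y, hy⟩) x
          have h2 : d x y ≤ d x x' + d x' y := hdtri x x' y
          nlinarith
      have := le_ciInf h
      linarith
    intro x x'
    rw [abs_le]
    constructor
    · have := key x' x
      rw [hdcomm x' x] at this
      linarith
    · have := key x x'
      linarith
  · -- invariance under the maps `act a`
    intro a x
    obtain ⟨a', ha'⟩ := hactinv a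
    refine le_antisymm (le_ciInf ?_) (le_ciInf ?_)
    · rintro (_ | ⟨y, hy⟩)
      · exact hg_theta _
      · show g (act a x) ≤ f y + Λ * d x y
        have h := hg_le (some ⟨act a y, hactG a y hy⟩) (act a x)
        have hval : φ (some ⟨act a y, hactG a y hy⟩) (act a x) = f (act a y) + Λ * d (act a x) (act a y) := rfl
        rw [hval, hactf, hactd] at h
        exact h
    · rintro (_ | ⟨y, hy⟩)
      · exact hg_theta _
      · show g x ≤ f y + Λ * d (act a x) y
        have h := hg_le (some ⟨act a' y, hactG a' y hy⟩) x
        have hval : φ (some ⟨act a' y, hactG a' y hy⟩) x = f (act a' y) + Λ * d x (act a' y) := rfl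
        rw [hval] at h
        have h1 : f y = f (act a' y) := by rw [← hactf a (act a' y), ha']
        have h2 : d (act a x) y = d x (act a' y) := by rw [← hactd a x (act a' y), ha']
        rw [h1, h2]
        exact h
  · -- locality
    intro x x' hxx'
    have hφeq : ∀ i, φ i x = φ i x' := by
      rintro (_ | ⟨y, hy⟩)
      · rfl
      · show f y + Λ * d x y = f y + Λ * d x' y
        rw [hR x x' hxx' y]
    show (⨅ i, φ i x) = ⨅ i, φ i x'
    exact iInf_congr hφeq
  · -- measurability: `{g < t}` is open
    refine measurable_of_Iio fun t => ?_
    have hset : g ⁻¹' Iio t = ⋃ i, {x | φ i x < t} := by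
      ext x
      simp only [mem_preimage, mem_Iio, mem_iUnion, mem_setOf_eq]
      exact ciInf_lt_iff (hbdd x)
    rw [hset]
    exact (isOpen_iUnion fun i => isOpen_lt (hφcont i) continuous_const).measurableSet

end Summit.QuantumFields.YangMills.Theorems.PoincareLipschitz.TwoSidedOfConcentration
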